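import Literature.AlgebraicGeometry.Motives.MixedHodgeStructureAdditiveFunctions
import Literature.AlgebraicGeometry.Motives.MixedHodgeStructureHodgeClassesMultiplicity
import Literature.AlgebraicGeometry.Motives.MixedHodgeStructureHodgeTate
import Literature.AlgebraicGeometry.Motives.MixedHodgeStructureMultiplicityTateTwist
import Literature.AlgebraicGeometry.Motives.MixedHodgeExtensionTateTwist
import HarnessLib

/-!
# Multiplicity bounds: `[H : S] · χ(S) ≤ χ(H)`; `dim Hdgᵖ(H) ≤ [H : ℚ(-p)] ≤ h^{p,p}(H)`

Sequel to `MixedHodgeStructureAdditiveFunctions` (additive functions `χ` on mixed Hodge structures, Krause §13.1)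
and `MixedHodgeStructureHodgeClassesMultiplicity` (`dim Hdgᵖ(H) = [soc H : ℚ(-p)] ≤ [H : ℚ(-p)]`). Krause,
*Homological Theory of Representations*, Lemma 13.1.1 / (13.1.2): an additive function `χ ≥ 0` on a length category
is `χ = Σ_S χ(S) · χ_S` with `χ_S(X) = [X : S]` the Jordan–Hölder multiplicity — in particular
**`[X : S] · χ(S) ≤ χ(X)`** for every simple `S`, and `Σ_i [X : S_i] · χ(S_i) ≤ χ(X)` for pairwise non-isomorphic
simple `S_i`. For mixed Hodge structures (Cattani–El Zein–Griffiths–Lê, Thm. 3.2.18) this file proves: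

* §1 `IsAdditive.multiplicity_mul_apply_le`: `[H : S] · χ(S) ≤ χ(H)` for every `ℕ`-valued additive `χ`, and the
  finite-sum form over pairwise non-isomorphic simple MHS (`IsAdditive.sum_multiplicity_mul_apply_le`).
* §2 instances: `[H : S] · dim S ≤ dim H`, `[H : S] · λ(S) ≤ λ(H)`, **`[H : S] · h^{p,q}(S) ≤ h^{p,q}(H)`**
  (any universe for `S`, by transport to a composition factor of `H`).
* §3 the Tate object: `h^{p,p}(ℚ(-p)) = 1`, hence **`[H : ℚ(-p)] ≤ h^{p,p}(H)`** and, with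
  `finrank_hodgeClasses_le_multiplicity`, the chain **`dim_ℚ Hdgᵖ(H) ≤ [H : ℚ(-p)] ≤ h^{p,p}(H)`** for every mixed
  Hodge structure (refining the classical bound `dim Hdgᵖ ≤ h^{p,p}`, the tree's
  `HodgeStructure.finrank_hodgeClasses_le_hodgeNumber` for pure structures); the defect term
  `[H/soc H : ℚ(-p)]` is likewise bounded by `h^{p,p}(H) − dim Hdgᵖ(H)`.
* §4 Tate twists: `Hdgᵖ(H(j)) = Hdg^{p+j}(H)`, `[H(j) : ℚ(-p)] = [H : ℚ(-p-j)]` (via the tree's `ℚ(-p)(n) = ℚ(-(p-n))`).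

All statements proved; no definitions, no named facts, no instances.

## References

* [Krause2021] H. Krause, Homological Theory of Representations (2021), §13.1, Lemma 13.1.1 and (13.1.2).
* [Jannsen1990MixedMotives] U. Jannsen, Mixed Motives and Algebraic K-Theory, LNM 1400 (1990), 7.8 (p. 94).
* [CattaniElZeinGriffithsLe2014] E. Cattani et al. (eds.), Hodge Theory (2014), Thm. 3.2.18, §3.2.2.6, Ex. 3.2.23 (1), (4).
* [Arapura2022] D. Arapura, Hodge cycles and the Leray filtration, Pacific J. Math. 319 (2022), §1 (p. 3).
-/

noncomputable section

namespace Literature.AlgebraicGeometry.Motives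

namespace MixedHodgeStructure

open Module SubMixedHodgeStructure

universe u w

section IsoHelpers

variable {W₁ : Type*} [AddCommGroup W₁] [Module ℚ W₁] {G₁ : MixedHodgeStructure W₁}
variable {W₂ : Type*} [AddCommGroup W₂] [Module ℚ W₂] {G₂ : MixedHodgeStructure W₂}
variable {W₃ : Type*} [AddCommGroup W₃] [Module ℚ W₃] {G₃ : MixedHodgeStructure W₃}

/-- "Isomorphic" is symmetric. [cite: CattaniElZeinGriffithsLe2014, Thm. 3.2.18] -/
private theorem iso_symm (h : ∃ e : Hom G₁ G₂, Function.Bijective e.toLinearMap) :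
    ∃ e : Hom G₂ G₁, Function.Bijective e.toLinearMap := by
  obtain ⟨e, he⟩ := h
  refine ⟨e.inverse he, ?_⟩
  rw [Hom.inverse_toLinearMap]
  exact (LinearEquiv.ofBijective e.toLinearMap he).symm.bijective

/-- "Isomorphic" is transitive. [cite: CattaniElZeinGriffithsLe2014, Thm. 3.2.18] -/
private theorem iso_trans (h₁ : ∃ e : Hom G₁ G₂, Function.Bijective e.toLinearMap)
    (h₂ : ∃ e : Hom G₂ G₃, Function.Bijective e.toLinearMap) :
    ∃ e : Hom G₁ G₃, Function.Bijective e.toLinearMap := by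
  obtain ⟨e₁, he₁⟩ := h₁
  obtain ⟨e₂, he₂⟩ := h₂
  refine ⟨e₂.comp e₁, ?_⟩
  rw [Hom.comp_toLinearMap, LinearMap.coe_comp]
  exact he₂.comp he₁

end IsoHelpers

variable {χ : ∀ (U : Type u) [AddCommGroup U] [Module ℚ U] [FiniteDimensional ℚ U], MixedHodgeStructure U → ℕ}
variable {V : Type u} [AddCommGroup V] [Module ℚ V] {H : MixedHodgeStructure V}
variable {U₀ : Type w} [AddCommGroup U₀] [Module ℚ U₀] {S : MixedHodgeStructure U₀}

/-! ### §1 `[H : S] · χ(S) ≤ χ(H)` for `ℕ`-valued additive functions -/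

namespace IsAdditive

/-- The auxiliary induction on the length for `multiplicity_mul_apply_le`. [cite: Krause2021, §13.1, (13.1.2)] -/
private theorem mul_le_aux (hχ : IsAdditive χ) {U : Type u} [AddCommGroup U] [Module ℚ U] [FiniteDimensional ℚ U]
    (S : MixedHodgeStructure U) (n : ℕ) : ∀ {W : Type u} [AddCommGroup W] [Module ℚ W] [FiniteDimensional ℚ W]
    (K : MixedHodgeStructure W), K.length ≤ n → K.multiplicity S * χ U S ≤ χ W K := by
  classical
  induction n with
  | zero =>
    intro W _ _ _ K hn
    haveI : Subsingleton W := length_eq_zero_iff.1 (Nat.le_zero.1 hn)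
    rw [multiplicity_eq_zero_of_subsingleton, zero_mul]
    exact Nat.zero_le _
  | succ n ih =>
    intro W _ _ _ K hn
    by_cases hW : Subsingleton W
    · rw [multiplicity_eq_zero_of_subsingleton, zero_mul]
      exact Nat.zero_le _
    rw [not_subsingleton_iff_nontrivial] at hW
    obtain ⟨S₀, hS₀⟩ := K.exists_subMixedHodgeStructure_isSimple
    have hlen : S₀.quotient.length ≤ n := by
      haveI := hS₀.nontrivial
      have h1 := S₀.length_quotient_lt (Submodule.nontrivial_iff_ne_bot.1 inferInstance)
      omega
    have h0 : S₀.toMixedHodgeStructure.multiplicity S * χ U S ≤ χ _ S₀.toMixedHodgeStructure := by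
      rw [hS₀.multiplicity_eq S]
      split_ifs with he
      · obtain ⟨e, he⟩ := he
        rw [one_mul, hχ.iso e he]
      · rw [zero_mul]
        exact Nat.zero_le _
    rw [← S₀.multiplicity_add S, add_mul, hχ.add K S₀]
    exact add_le_add h0 (ih S₀.quotient hlen)

/-- **`[H : S] · χ(S) ≤ χ(H)`** for every `ℕ`-valued additive function `χ` (the term of `S` in Krause's
`χ = Σ_S χ(S) · χ_S`, (13.1.2)). [cite: Krause2021, §13.1, Lemma 13.1.1 and (13.1.2)] [cite: CattaniElZeinGriffithsLe2014, Thm. 3.2.18] -/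
theorem multiplicity_mul_apply_le [FiniteDimensional ℚ V] (hχ : IsAdditive χ) {U : Type u} [AddCommGroup U]
    [Module ℚ U] [FiniteDimensional ℚ U] (S : MixedHodgeStructure U) : H.multiplicity S * χ U S ≤ χ V H :=
  mul_le_aux hχ S H.length H le_rfl

/-- `χ(S) ≤ χ(H)` whenever `S` is a composition factor of `H`. [cite: Krause2021, §13.1, (13.1.2)] -/
theorem apply_le_of_multiplicity_pos [FiniteDimensional ℚ V] (hχ : IsAdditive χ) {U : Type u} [AddCommGroup U]
    [Module ℚ U] [FiniteDimensional ℚ U] {S : MixedHodgeStructure U} (hS : 0 < H.multiplicity S) : χ U S ≤ χ V H :=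
  (Nat.le_mul_of_pos_left _ hS).trans (hχ.multiplicity_mul_apply_le S)

/-- The auxiliary induction for the finite-sum form. [cite: Krause2021, §13.1, (13.1.2)] -/
private theorem sum_mul_le_aux (hχ : IsAdditive χ) {ι : Type*} [Fintype ι] {Uι : ι → Type u}
    [∀ i, AddCommGroup (Uι i)] [∀ i, Module ℚ (Uι i)] [∀ i, FiniteDimensional ℚ (Uι i)]
    (Sι : ∀ i, MixedHodgeStructure (Uι i))
    (hne : ∀ i j, (∃ e : Hom (Sι i) (Sι j), Function.Bijective e.toLinearMap) → i = j) (n : ℕ) :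
    ∀ {W : Type u} [AddCommGroup W] [Module ℚ W] [FiniteDimensional ℚ W] (K : MixedHodgeStructure W),
      K.length ≤ n → ∑ i, K.multiplicity (Sι i) * χ _ (Sι i) ≤ χ W K := by
  classical
  induction n with
  | zero =>
    intro W _ _ _ K hn
    haveI : Subsingleton W := length_eq_zero_iff.1 (Nat.le_zero.1 hn)
    rw [Finset.sum_eq_zero fun i _ => by rw [multiplicity_eq_zero_of_subsingleton, zero_mul]]
    exact Nat.zero_le _
  | succ n ih =>
    intro W _ _ _ K hn
    by_cases hW : Subsingleton W
    · rw [Finset.sum_eq_zero fun i _ => by rw [multiplicity_eq_zero_of_subsingleton, zero_mul]]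
      exact Nat.zero_le _
    rw [not_subsingleton_iff_nontrivial] at hW
    obtain ⟨S₀, hS₀⟩ := K.exists_subMixedHodgeStructure_isSimple
    have hlen : S₀.quotient.length ≤ n := by
      haveI := hS₀.nontrivial
      have h1 := S₀.length_quotient_lt (Submodule.nontrivial_iff_ne_bot.1 inferInstance)
      omega
    -- at most one `S_i` is isomorphic to the simple `S₀`
    have h0 : ∑ i, S₀.toMixedHodgeStructure.multiplicity (Sι i) * χ _ (Sι i) ≤ χ _ S₀.toMixedHodgeStructure := by
      by_cases hex : ∃ i, ∃ e : Hom S₀.toMixedHodgeStructure (Sι i), Function.Bijective e.toLinearMap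
      · obtain ⟨i₀, e, he⟩ := hex
        rw [Finset.sum_eq_single i₀ (fun j _ hj => ?_) (fun h => absurd (Finset.mem_univ i₀) h),
          hS₀.multiplicity_eq, if_pos ⟨e, he⟩, one_mul, hχ.iso e he]
        rw [hS₀.multiplicity_eq, if_neg, zero_mul]
        rintro ⟨e', he'⟩
        exact hj (hne j i₀ (iso_trans (iso_symm ⟨e', he'⟩) ⟨e, he⟩))
      · rw [Finset.sum_eq_zero fun i _ => by
          rw [hS₀.multiplicity_eq, if_neg (fun h => hex ⟨i, h⟩), zero_mul]]
        exact Nat.zero_le _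
    have hsplit : ∑ i, K.multiplicity (Sι i) * χ _ (Sι i) =
        ∑ i, S₀.toMixedHodgeStructure.multiplicity (Sι i) * χ _ (Sι i) +
          ∑ i, S₀.quotient.multiplicity (Sι i) * χ _ (Sι i) := by
      rw [← Finset.sum_add_distrib]
      exact Finset.sum_congr rfl fun i _ => by rw [← S₀.multiplicity_add (Sι i), add_mul]
    rw [hsplit, hχ.add K S₀]
    exact add_le_add h0 (ih S₀.quotient hlen)

/-- **`Σ_i [H : S_i] · χ(S_i) ≤ χ(H)`** for pairwise non-isomorphic MHS `S_i` and an `ℕ`-valued additive `χ`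
(the partial sums of Krause's (13.1.2)). [cite: Krause2021, §13.1, Lemma 13.1.1 and (13.1.2)] -/
theorem sum_multiplicity_mul_apply_le [FiniteDimensional ℚ V] (hχ : IsAdditive χ) {ι : Type*} [Fintype ι]
    {Uι : ι → Type u} [∀ i, AddCommGroup (Uι i)] [∀ i, Module ℚ (Uι i)] [∀ i, FiniteDimensional ℚ (Uι i)]
    (Sι : ∀ i, MixedHodgeStructure (Uι i))
    (hne : ∀ i j, (∃ e : Hom (Sι i) (Sι j), Function.Bijective e.toLinearMap) → i = j) :
    ∑ i, H.multiplicity (Sι i) * χ _ (Sι i) ≤ χ V H :=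
  sum_mul_le_aux hχ Sι hne H.length H le_rfl

end IsAdditive

/-! ### §2 Instances: dimension, length, Hodge numbers -/

/-- **`[H : S] · h^{p,q}(S) ≤ h^{p,q}(H)`** (any `S`; by transport of `S` to a composition factor of `H`).
[cite: Krause2021, §13.1, (13.1.2)] [cite: CattaniElZeinGriffithsLe2014, Cor. 3.2.21 (ii) and §3.2.2.6] -/
theorem multiplicity_mul_hodgeNumber_le [FiniteDimensional ℚ V] [FiniteDimensional ℚ U₀] (H : MixedHodgeStructure V)
    (S : MixedHodgeStructure U₀) (p q : ℤ) : H.multiplicity S * S.hodgeNumber p q ≤ H.hodgeNumber p q := by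
  by_cases hpos : 0 < H.multiplicity S
  · obtain ⟨A, B, -, e, he⟩ := exists_subquotientIsoTo_of_multiplicity_pos hpos
    rw [← multiplicity_congr H e he, ← Hom.hodgeNumber_eq_of_bijective e he p q]
    exact (isAdditive_hodgeNumber p q).multiplicity_mul_apply_le (H := H) _
  · rw [Nat.eq_zero_of_not_pos hpos, zero_mul]
    exact Nat.zero_le _

/-- **`[H : S] · dim S ≤ dim H`.** [cite: Krause2021, §13.1, (13.1.2)] [cite: CattaniElZeinGriffithsLe2014, Thm. 3.2.18] -/
theorem multiplicity_mul_finrank_le [FiniteDimensional ℚ V] [FiniteDimensional ℚ U₀] (H : MixedHodgeStructure V)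
    (S : MixedHodgeStructure U₀) : H.multiplicity S * finrank ℚ U₀ ≤ finrank ℚ V := by
  by_cases hpos : 0 < H.multiplicity S
  · obtain ⟨A, B, -, e, he⟩ := exists_subquotientIsoTo_of_multiplicity_pos hpos
    rw [← multiplicity_congr H e he, ← (LinearEquiv.ofBijective e.toLinearMap he).finrank_eq]
    exact isAdditive_finrank.multiplicity_mul_apply_le (H := H) _
  · rw [Nat.eq_zero_of_not_pos hpos, zero_mul]
    exact Nat.zero_le _

/-- **`[H : S] · λ(S) ≤ λ(H)`** (for simple `S`: `[H : S] ≤ λ(H)`, the tree's `multiplicity_le_length`).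
[cite: Krause2021, §13.1, (13.1.2)] [cite: CattaniElZeinGriffithsLe2014, Thm. 3.2.18] -/
theorem multiplicity_mul_length_le [FiniteDimensional ℚ V] [FiniteDimensional ℚ U₀] (H : MixedHodgeStructure V)
    (S : MixedHodgeStructure U₀) : H.multiplicity S * S.length ≤ H.length := by
  by_cases hpos : 0 < H.multiplicity S
  · obtain ⟨A, B, -, e, he⟩ := exists_subquotientIsoTo_of_multiplicity_pos hpos
    rw [← multiplicity_congr H e he, ← length_eq_of_bijective e he]
    exact isAdditive_length.multiplicity_mul_apply_le (H := H) _
  · rw [Nat.eq_zero_of_not_pos hpos, zero_mul]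
    exact Nat.zero_le _

/-- A composition factor has smaller Hodge numbers: `h^{p,q}(S) ≤ h^{p,q}(H)` if `[H : S] > 0`.
[cite: CattaniElZeinGriffithsLe2014, Cor. 3.2.21 (ii)] -/
theorem hodgeNumber_le_of_multiplicity_pos [FiniteDimensional ℚ V] [FiniteDimensional ℚ U₀] {H : MixedHodgeStructure V}
    {S : MixedHodgeStructure U₀} (hS : 0 < H.multiplicity S) (p q : ℤ) : S.hodgeNumber p q ≤ H.hodgeNumber p q :=
  (Nat.le_mul_of_pos_left _ hS).trans (multiplicity_mul_hodgeNumber_le H S p q)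

/-! ### §3 The Tate object: `dim Hdgᵖ(H) ≤ [H : ℚ(-p)] ≤ h^{p,p}(H)` -/

/-- `h^{p,p}(ℚ(-p)) = 1` (as a mixed Hodge structure). [cite: CattaniElZeinGriffithsLe2014, Ex. 3.2.23 (1)] -/
theorem hodgeNumber_tate_toMixedHodgeStructure_self (p : ℤ) :
    (HodgeStructure.tate (-p)).toMixedHodgeStructure.hodgeNumber p p = 1 := by
  rw [HodgeStructure.toMixedHodgeStructure_hodgeNumber]
  have h := hodgeNumber_tate (-p)
  rwa [neg_neg] at h

/-- **`[H : ℚ(-p)] ≤ h^{p,p}(H)`**: every composition factor `ℚ(-p)` contributes `1` to `h^{p,p}`.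
[cite: Krause2021, §13.1, (13.1.2)] [cite: CattaniElZeinGriffithsLe2014, Cor. 3.2.21 (ii) and §3.2.2.6] -/
theorem multiplicity_tate_le_hodgeNumber [FiniteDimensional ℚ V] (H : MixedHodgeStructure V) (p : ℤ) :
    H.multiplicity (HodgeStructure.tate (-p)).toMixedHodgeStructure ≤ H.hodgeNumber p p := by
  have h := multiplicity_mul_hodgeNumber_le H (HodgeStructure.tate (-p)).toMixedHodgeStructure p p
  rwa [hodgeNumber_tate_toMixedHodgeStructure_self, mul_one] at h

/-- **`dim_ℚ Hdgᵖ(H) ≤ h^{p,p}(H)` for every mixed Hodge structure**, through the chain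
`dim Hdgᵖ(H) ≤ [H : ℚ(-p)] ≤ h^{p,p}(H)`. [cite: Jannsen1990MixedMotives, 7.8 (p. 94)] [cite: Arapura2022, §1 (p. 3)]
[cite: CattaniElZeinGriffithsLe2014, §3.2.2.6] -/
theorem finrank_hodgeClasses_le_hodgeNumber [FiniteDimensional ℚ V] (H : MixedHodgeStructure V) (p : ℤ) :
    finrank ℚ (H.hodgeClasses p) ≤ H.hodgeNumber p p :=
  (finrank_hodgeClasses_le_multiplicity H p).trans (multiplicity_tate_le_hodgeNumber H p)

/-- The defect is bounded too: `dim Hdgᵖ(H) + [H/soc H : ℚ(-p)] ≤ h^{p,p}(H)`. [cite: Jannsen1990MixedMotives, 7.8 (p. 94)]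
[cite: CattaniElZeinGriffithsLe2014, §3.2.2.6] -/
theorem finrank_hodgeClasses_add_multiplicity_quotient_socle_le_hodgeNumber [FiniteDimensional ℚ V]
    (H : MixedHodgeStructure V) (p : ℤ) :
    finrank ℚ (H.hodgeClasses p) + (socle H).quotient.multiplicity (HodgeStructure.tate (-p)).toMixedHodgeStructure ≤
      H.hodgeNumber p p := by
  rw [finrank_hodgeClasses_add_multiplicity_quotient_socle H p]
  exact multiplicity_tate_le_hodgeNumber H p

/-- For a semisimple `H` with `h^{p,p}(H) = [H : ℚ(-p)]` (all of `h^{p,p}` carried by factors `ℚ(-p)`):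
`dim Hdgᵖ(H) = h^{p,p}(H)`. [cite: Jannsen1990MixedMotives, 7.8 b) (p. 94)] -/
theorem IsSemisimple.finrank_hodgeClasses_eq_hodgeNumber [FiniteDimensional ℚ V] (hH : H.IsSemisimple) {p : ℤ}
    (h : H.multiplicity (HodgeStructure.tate (-p)).toMixedHodgeStructure = H.hodgeNumber p p) :
    finrank ℚ (H.hodgeClasses p) = H.hodgeNumber p p := by
  rw [hH.finrank_hodgeClasses_eq_multiplicity, h]

/-! ### §4 Tate twists -/

/-- **`[H(j) : ℚ(-p)] = [H : ℚ(-(p+j))]`** (`ℚ(-p)(-j) = ℚ(-(p+j))`, the tree's `tate_toMixedHodgeStructure_tateTwist`).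
[cite: CattaniElZeinGriffithsLe2014, Ex. 3.2.23 (4)] [cite: Krause2021, §13.1, (13.1.2)] -/
theorem multiplicity_tateTwist_tate_neg [FiniteDimensional ℚ V] (H : MixedHodgeStructure V) (p j : ℤ) :
    (H.tateTwist j).multiplicity (HodgeStructure.tate (-p)).toMixedHodgeStructure =
      H.multiplicity (HodgeStructure.tate (-(p + j))).toMixedHodgeStructure := by
  rw [multiplicity_tateTwist_tate, tate_toMixedHodgeStructure_tateTwist, show p - -j = p + j by ring]

/-- **`Hdgᵖ(H(j)) = Hdg^{p+j}(H)`**: `W_{2p} H(j) = W_{2p+2j} H` and `Fᵖ H(j) = F^{p+j} H`.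
[cite: CattaniElZeinGriffithsLe2014, Ex. 3.2.23 (4)] [cite: Arapura2022, §1 (p. 3)] -/
theorem hodgeClasses_tateTwist (H : MixedHodgeStructure V) (j p : ℤ) :
    (H.tateTwist j).hodgeClasses p = H.hodgeClasses (p + j) := by
  ext v
  rw [mem_hodgeClasses_iff, mem_hodgeClasses_iff, tateTwist_W, tateTwist_F,
    show 2 * p + 2 * j = 2 * (p + j) by ring]

/-- `dim Hdgᵖ(H(j)) = dim Hdg^{p+j}(H)`. [cite: CattaniElZeinGriffithsLe2014, Ex. 3.2.23 (4)] -/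
theorem finrank_hodgeClasses_tateTwist (H : MixedHodgeStructure V) (j p : ℤ) :
    finrank ℚ ((H.tateTwist j).hodgeClasses p) = finrank ℚ (H.hodgeClasses (p + j)) := by
  rw [hodgeClasses_tateTwist]

/-- Consistency of `dim Hdgᵖ(H) = [soc H : ℚ(-p)]` with twisting: both sides of
`dim Hdgᵖ(H(j)) ≤ [H(j) : ℚ(-p)]` are the corresponding quantities of `H` at `p + j`.
[cite: Jannsen1990MixedMotives, 7.8 (p. 94)] [cite: CattaniElZeinGriffithsLe2014, Ex. 3.2.23 (4)] -/
theorem finrank_hodgeClasses_le_multiplicity_tateTwist [FiniteDimensional ℚ V] (H : MixedHodgeStructure V) (j p : ℤ) :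
    finrank ℚ (H.hodgeClasses (p + j)) ≤ H.multiplicity (HodgeStructure.tate (-(p + j))).toMixedHodgeStructure := by
  have h := finrank_hodgeClasses_le_multiplicity (H.tateTwist j) p
  rwa [finrank_hodgeClasses_tateTwist, multiplicity_tateTwist_tate_neg] at h

end MixedHodgeStructure

end Literature.AlgebraicGeometry.Motives
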